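import Literature.NumberTheory.LFunctions.ThetaChainFreeCheck
import HarnessLib

/-!
# Schoenfeld's `θ`-bound on `[599, 10⁸]` by kernel computation: data-free run, chunk 17 of 35

Topic: `Literature/NumberTheory/LFunctions`. Pure proof file (a kernel computation; nothing is
asserted, no definition). The theorems below evaluate `ThetaChain.runFree` — together `150000`
data-free steps of the certified `θ`-chain (`ThetaChain.stepFree`, `ThetaChainFreeCheck.lean`: the
next prime found and certified by two gcds with the primorials of the odd primes `≤ 2999` and in
`(2999, 10007]`, the enclosures of `log p` and `θ(p)`, and the two comparisons behind
`|θ(x) − x| ≤ √x log² x/(8π)`) — from the state at the prime `49896941` to the state at the prime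
`52560713`. Soundness: `ThetaChain.runFree_sound`; assembly of the 35 chunks: `ThetaUpTo1e8.lean`.
The expected states were obtained by evaluating a twin of the same function outside the kernel
(validated bit-for-bit on the tree's chunk `ThetaChainRun.xrun14`). Declarations of `5·10⁴` steps
(about `70 s` of kernel time each; the kernel's evaluation is linear within a declaration of this size),
`decide +kernel`, standard axioms only (`maxHeartbeats 0` lifts the deterministic time-out).

## References

* L. Schoenfeld, *Sharper bounds for the Chebyshev functions θ(x) and ψ(x). II*, Math. Comp. 30
  (1976), 337–360, Thm. 10 (6.3). [Schoenfeld1976]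
* J. B. Rosser, L. Schoenfeld, *Approximate formulas for some functions of prime numbers*,
  Illinois J. Math. 6 (1962), 64–94, Thms. 18–19 (`θ`-tables to `10⁸`). [RosserSchoenfeld1962]
-/

namespace Literature.NumberTheory.LFunctions.ThetaChainRun

open ThetaChain

set_option maxHeartbeats 0 in
/-- **Data-free certified `θ`-run, chunk 17a** (steps `2400001`–`2450000` after `8886113`: 50000 primes,
`49896941` to `50783881`). [cite: Schoenfeld1976, Thm. 10 (6.3)] -/
theorem frun17a :
    runFree 50000
      ⟨49896941, 21428778657576360138629418, 21428778657576835805685305, 60314573603718343274929856568865, 60314573603719767971685571204084⟩ =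
    some ⟨50783881, 21450079087667404606774844, 21450079087667880274783706, 61386547390811970194050364782156, 61386547390813418674182703386275⟩ := by
  decide +kernel

set_option maxHeartbeats 0 in
/-- **Data-free certified `θ`-run, chunk 17b** (steps `2450001`–`2500000` after `8886113`: 50000 primes,
`50783881` to `51672659`). [cite: Schoenfeld1976, Thm. 10 (6.3)] -/
theorem frun17b :
    runFree 50000
      ⟨50783881, 21450079087667404606774844, 21450079087667880274783706, 61386547390811970194050364782156, 61386547390813418674182703386275⟩ =
    some ⟨51672659, 21471053710167296408636530, 21471053710167772077598412, 62459577378220150375824924057071, 62459577378221622639381532322925⟩ := by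
  decide +kernel

set_option maxHeartbeats 0 in
/-- **Data-free certified `θ`-run, chunk 17c** (steps `2500001`–`2550000` after `8886113`: 50000 primes,
`51672659` to `52560713`). [cite: Schoenfeld1976, Thm. 10 (6.3)] -/
theorem frun17c :
    runFree 50000
      ⟨51672659, 21471053710167296408636530, 21471053710167772077598412, 62459577378220150375824924057071, 62459577378221622639381532322925⟩ =
    some ⟨52560713, 21491653972194351938045963, 21491653972194827607960315, 63533645749727651968160791580196, 63533645749729148015189309631275⟩ := by
  decide +kernel

end Literature.NumberTheory.LFunctions.ThetaChainRun
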